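import Summits.SmoothPoincare4.SmoothPoincare4.Theorems.DottedCircleRasmussenDcrGapRungZero

/-!
# Crux `DcrGap` (stmt-SmoothPoincare4-16128), line `Sketch` — the rung decomposition of the crux

Helper `helper_rungDecomposition` of the line (registered on the crux item): the ONE-HANDLE SLICE GAP
splits by the number `k` of dotted circles as

  `DcrGap ↔ ZseHsliceNotSlice ∨ (∃ k ≥ 1, a gap datum at level k)`,

where rung `0` has been identified with the Freedman–Gompf–Morrison–Walker waypoint
`ZeroSurgeryExotic.ZseHsliceNotSlice` (item stmt-SmoothPoincare4-0520) by the landed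
`helper_rungZeroIff`. So the route's surplus over FGMW is EXACTLY its rungs `k ≥ 1` (the engine
`DcrRasmussenWitness` lives there: it demands `1 ≤ k`). Pure logic over `helper_rungZeroIff`; the
level-`k` gap datum is written in the Literature vocabulary (`MMSW.IsModelKnot k`,
`MMSW.IsSliceDiscInComplement k`), definitionally the route's binders (`Iff.rfl`).
No definitions, no named facts, no `sorry`.

References: Freedman–Gompf–Morrison–Walker, Quantum Topol. 1 (2010), §1
[FreedmanGompfMorrisonWalker2010]; Manolescu–Marengon–Sarkar–Willis, Duke Math. J. 172 (2023), §9.3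
[ManolescuMarengonSarkarWillis2023].
-/

noncomputable section

set_option linter.dupNamespace false

open scoped Manifold ContDiff Topology
open Function Set
open Literature.Topology.FourManifolds

namespace Summit.SmoothPoincare4.SmoothPoincare4.Theorems.DcrGap.Sketch

/-- **Helper `helper_rungDecomposition` (line `Sketch`): the rung decomposition of `DcrGap`.** The
one-handle slice gap holds iff EITHER some `S³`-knot is slice in a homotopy 4-ball but not in `B⁴`
(rung `0`, `helper_rungZeroIff`) OR there is a gap datum with `k ≥ 1` dotted circles (a model knot
`K ⊂ ∂D_k`, complement-slice in some homotopy 4-sphere, in no `N ≅ S⁴`). Case split on `k = 0`.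
[cite: FreedmanGompfMorrisonWalker2010, §1] [cite: ManolescuMarengonSarkarWillis2023, §9.3] -/
theorem helper_rungDecomposition : Summit.SmoothPoincare4.SmoothPoincare4.Theses.DottedCircleRasmussen.DcrGap ↔ (Summit.SmoothPoincare4.SmoothPoincare4.Theses.ZeroSurgeryExotic.ZseHsliceNotSlice ∨ ∃ k : ℕ, 1 ≤ k ∧ ∃ K : (Metric.sphere (0 : EuclideanSpace ℝ (Fin 2)) 1) → EuclideanSpace ℝ (Fin 4), Literature.Topology.FourManifolds.MMSW.IsModelKnot k K ∧ (∃ (M : Type) (_ : TopologicalSpace M) (_ : T2Space M) (_ : SecondCountableTopology M) (_ : ChartedSpace (EuclideanSpace ℝ (Fin 4)) M) (_ : IsManifold (𝓡 4) ((⊤ : ℕ∞) : WithTop ℕ∞) M), Nonempty (ContinuousMap.HomotopyEquiv M (Metric.sphere (0 : EuclideanSpace ℝ (Fin 5)) 1)) ∧ ∃ (e : EuclideanSpace ℝ (Fin 4) → M) (f : EuclideanSpace ℝ (Fin 2) → M), Literature.Topology.FourManifolds.MMSW.IsSliceDiscInComplement k K M e f) ∧ ∀ (N : Type) [TopologicalSpace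 N] [T2Space N] [SecondCountableTopology N] [ChartedSpace (EuclideanSpace ℝ (Fin 4)) N] [IsManifold (𝓡 4) ((⊤ : ℕ∞) : WithTop ℕ∞) N], Nonempty (Diffeomorph (𝓡 4) (𝓡 4) N (Metric.sphere (0 : EuclideanSpace ℝ (Fin 5)) 1) ((⊤ : ℕ∞) : WithTop ℕ∞)) → ∀ (e' : EuclideanSpace ℝ (Fin 4) → N) (f' : EuclideanSpace ℝ (Fin 2) → N), ¬ Literature.Topology.FourManifolds.MMSW.IsSliceDiscInComplement k K N e' f') := by
  constructor
  · rintro ⟨k, K, hK, hM, hno⟩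
    rcases Nat.eq_zero_or_pos k with rfl | hk
    · exact Or.inl (helper_rungZeroIff.1 ⟨K, hK, hM, hno⟩)
    · exact Or.inr ⟨k, hk, K, hK, hM, hno⟩
  · rintro (h | ⟨k, -, K, hK, hM, hno⟩)
    · obtain ⟨K, hK, hM, hno⟩ := helper_rungZeroIff.2 h
      exact ⟨0, K, hK, hM, hno⟩
    · exact ⟨k, K, hK, hM, hno⟩

end Summit.SmoothPoincare4.SmoothPoincare4.Theorems.DcrGap.Sketch

end
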